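import Literature.Algebra.Homology.BaseChangeComplex
import Literature.Algebra.Homology.KernelBaseChangeTestAlgebraTransport
import Mathlib.LinearAlgebra.Quotient.Basic
import Mathlib.LinearAlgebra.Dimension.Finrank
import Mathlib.RingTheory.Finiteness.Basic
import HarnessLib

/-!
# `H^b_mkQ(κ ⊗_A K•)` does not depend on the presentation of the test algebra `κ`: transport along a ring isomorphism `κ ≃+* κ′` over `A`
# ([Weibel1994] §1.1; [MumfordAV1970] §5 Cor. 3; [AtiyahMacdonald1969] Prop. 2.14)

Layer `Literature/Algebra/Homology`, namespace `Literature.Algebra.Homology`.  THEOREMS ONLY (no definition, no named fact, no instance, no notation,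
no `sorry`), Mathlib + ★ `BaseChangeComplex` (`baseChangeComplex κ K•`: `X n = κ ⊗_A Kⁿ`, `d = d ⊗ κ`) + ★ `KernelBaseChangeTestAlgebraTransport` §1
(`rTensor_algEquiv_smul`: `e ⊗ 1` is semilinear over `e`).  Cell `hodgecm-mathlib` (D-0151), «H1-DIM-ANY-CHAR cut», FILE 2 (E3) of B-p04 (g42)՚s HEAD
assembly (deal 2026-09-02T03:34Z to LA1-p02 (g2)): the entry point ★ `finrank_HOne_baseChangeComplex_residueField_eq_finrank_cotangentSpace` and the tower ★
(J10-i) `finrank_HOne_baseChangeComplex_tower_eq` speak of `H¹(κ ⊗_A K•)` for the ABSTRACT residue field `κ := ResidueField 𝒪_{V,0̂}` (algebra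
`Γ(V) → 𝒪_{V,0̂} → κ`), while the Čech side (★ (J10-iii-a) `finrank_HmkQ_baseChangeComplex_eq_of_isPullback`) speaks of `κ′ := Γ(Spec K, 𝒪)` with the algebra
structure `(t₀.appLE ⊤ ⊤ _).toAlgebra`; the two are isomorphic as rings COMPATIBLY WITH THE STRUCTURE MAPS FROM `A = Γ(V)`, and this file moves the map-`mkQ`
cohomology `H^b_mkQ = ↥((ker d^{b,c}).map (range d^{a,b}).mkQ)`, its `finrank` and its finiteness across such an isomorphism — the `H_mkQ` analogue of ★ p848239
§1 `finrank_ker_baseChange_eq_of_ringEquiv`.  HC_CM is proved only modulo the 7 printed citations until rung 0 closes; nothing here bears on a summit statement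
(count-neutral capital).

THE MATHEMATICS.  A ring isomorphism `e : κ ⥲ κ′` with `e ∘ algebraMap = algebraMap` is an `A`-algebra isomorphism, so `e ⊗ 1 : κ ⊗_A Kⁿ ⥲ κ′ ⊗_A Kⁿ` is an
additive bijection, SEMILINEAR over `e` (`(e ⊗ 1)(r·w) = e(r)·(e ⊗ 1)(w)`), commuting with `d ⊗ κ`, `d ⊗ κ′` in every degree; an `e`-semilinear isomorphism
of complexes identifies cocycles with cocycles and coboundaries with coboundaries ([Weibel1994] §1.1), hence induces an `e`-semilinear additive bijection
`H^b_mkQ(κ ⊗ K•) ⥲ H^b_mkQ(κ′ ⊗ K•)`; ranks agree along a semilinear bijection over a ring isomorphism (Mathlib `rank_eq_of_equiv_equiv`) and so does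
finite generation (Mathlib `LinearMap.finite_iff_of_bijective`).

* §1 (generic, `σ`-semilinear for a `RingHomInvPair σ σ′`) `map_range_eq_range_of_commₛₗ`, `map_ker_eq_ker_of_commₛₗ`,
  **`nonempty_HmkQ_semilinearEquiv_of_comm`** — degreewise semilinear isomorphisms `e₀ e₁ e₂` commuting with `A₀ → A₁ → A₂` (over `κ`) and
  `B₀ → B₁ → B₂` (over `κ′`) give `↥((ker a₂).map (range a₁).mkQ) ≃ₛₗ[σ] ↥((ker b₂).map (range b₁).mkQ)` (the semilinear twin of ★ `nonempty_HOne_linearEquiv_of_comm`).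
* §2 (the base change) `rTensor_baseChange_comm` (`e ⊗ 1` intertwines `d ⊗ κ`, `d ⊗ κ′`), **`exists_HmkQ_baseChangeComplex_addEquiv_of_ringEquiv`**
  (`∃ Φ : H^b_mkQ(κ ⊗ K•) ≃+ H^b_mkQ(κ′ ⊗ K•), ∀ r x, Φ (r • x) = e r • Φ x`), **`finrank_HmkQ_baseChangeComplex_eq_of_ringEquiv`**
  (`finrank κ H^b_mkQ(κ ⊗ K•) = finrank κ′ H^b_mkQ(κ′ ⊗ K•)`), **`finite_HmkQ_baseChangeComplex_iff_of_ringEquiv`** (`Module.Finite κ _ ↔ Module.Finite κ′ _`).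
  The degrees `a b c` are free (no `a + 1 = b` needed).

## References
* [Weibel1994] C. A. Weibel, *An introduction to homological algebra* (1994), §1.1 (Def. 1.1.1, Ex. 1.1.2) (p. 2).
* [MumfordAV1970] D. Mumford, *Abelian Varieties* (1970), §5 Lemma 2 (p. 49) and Cor. 3 (p. 53).
* [AtiyahMacdonald1969] M. F. Atiyah, I. G. Macdonald, *Introduction to Commutative Algebra* (1969), Prop. 2.14 and (2.19) (pp. 26–31).
* [StacksProject] The Stacks Project, Tag 0111 (cohomology of complexes; functoriality).
-/

set_option autoImplicit false
set_option backward.isDefEq.respectTransparency false -- `↑((baseChangeComplex κ K).X n)` vs `κ ⊗[A] ↑(K.X n)` (ModuleCat carriers, as in ★ `BaseChangeComplexTowerHOne`)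

universe u

open TensorProduct

noncomputable section

namespace Literature.Algebra.Homology

/-! ## §1 Transport of `H_mkQ` along degreewise SEMILINEAR isomorphisms commuting with the differentials -/

section Semilinear

variable {κ κ' : Type u} [CommRing κ] [CommRing κ'] {σ : κ →+* κ'} {σ' : κ' →+* κ} [RingHomInvPair σ σ'] [RingHomInvPair σ' σ]
  {A₀ A₁ A₂ : Type u} [AddCommGroup A₀] [Module κ A₀] [AddCommGroup A₁] [Module κ A₁] [AddCommGroup A₂] [Module κ A₂]
  {B₀ B₁ B₂ : Type u} [AddCommGroup B₀] [Module κ' B₀] [AddCommGroup B₁] [Module κ' B₁] [AddCommGroup B₂] [Module κ' B₂]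

/-- A semilinear isomorphism intertwining `a : A₀ → A₁` and `b : B₀ → B₁` maps `range a` onto `range b` (an isomorphism of complexes identifies
coboundaries). [cite: Weibel1994, §1.1 (p. 2)] [cite: StacksProject, Tag 0111] -/
theorem map_range_eq_range_of_commₛₗ (a : A₀ →ₗ[κ] A₁) (b : B₀ →ₗ[κ'] B₁) (e₀ : A₀ ≃ₛₗ[σ] B₀) (e₁ : A₁ ≃ₛₗ[σ] B₁)
    (h : ∀ x, e₁ (a x) = b (e₀ x)) : (LinearMap.range a).map (e₁ : A₁ →ₛₗ[σ] B₁) = LinearMap.range b := by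
  apply le_antisymm
  · rintro _ ⟨_, ⟨x, rfl⟩, rfl⟩
    exact ⟨e₀ x, (h x).symm⟩
  · rintro _ ⟨y, rfl⟩
    refine ⟨a (e₀.symm y), ⟨_, rfl⟩, ?_⟩
    rw [LinearEquiv.coe_coe, h, LinearEquiv.apply_symm_apply]

/-- A semilinear isomorphism intertwining `a : A₁ → A₂` and `b : B₁ → B₂` (with a semilinear isomorphism on the targets) maps `ker a` onto `ker b`
(an isomorphism of complexes identifies cocycles). [cite: Weibel1994, §1.1 (p. 2)] [cite: StacksProject, Tag 0111] -/
theorem map_ker_eq_ker_of_commₛₗ (a : A₁ →ₗ[κ] A₂) (b : B₁ →ₗ[κ'] B₂) (e₁ : A₁ ≃ₛₗ[σ] B₁) (e₂ : A₂ ≃ₛₗ[σ] B₂)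
    (h : ∀ x, e₂ (a x) = b (e₁ x)) : (LinearMap.ker a).map (e₁ : A₁ →ₛₗ[σ] B₁) = LinearMap.ker b := by
  apply le_antisymm
  · rintro _ ⟨x, hx, rfl⟩
    rw [SetLike.mem_coe, LinearMap.mem_ker] at hx
    rw [LinearMap.mem_ker, LinearEquiv.coe_coe, ← h, hx, map_zero]
  · intro y hy
    refine ⟨e₁.symm y, ?_, e₁.apply_symm_apply y⟩
    rw [LinearMap.mem_ker] at hy
    rw [SetLike.mem_coe, LinearMap.mem_ker]
    apply e₂.injective
    rw [h, LinearEquiv.apply_symm_apply, hy, map_zero]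

/-- **Transport of `H_mkQ` along a SEMILINEAR isomorphism of three-term complexes**: degreewise `σ`-semilinear isomorphisms `e₀, e₁, e₂` commuting with
`A₀ → A₁ → A₂` and `B₀ → B₁ → B₂` identify `↥((ker a₂).map (range a₁).mkQ)` with `↥((ker b₂).map (range b₁).mkQ)` `σ`-semilinearly (the quotient map
`A₁ ⧸ range a₁ → B₁ ⧸ range b₁` induced by `e₁` — Mathlib `Submodule.mapQ`, inverse induced by `e₁⁻¹` — restricted to the images of the cocycles).
[cite: Weibel1994, §1.1 (Def. 1.1.1, Ex. 1.1.2) (p. 2)] [cite: StacksProject, Tag 0111] -/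
theorem nonempty_HmkQ_semilinearEquiv_of_comm (a₁ : A₀ →ₗ[κ] A₁) (a₂ : A₁ →ₗ[κ] A₂) (b₁ : B₀ →ₗ[κ'] B₁) (b₂ : B₁ →ₗ[κ'] B₂)
    (e₀ : A₀ ≃ₛₗ[σ] B₀) (e₁ : A₁ ≃ₛₗ[σ] B₁) (e₂ : A₂ ≃ₛₗ[σ] B₂)
    (h₁ : ∀ x, e₁ (a₁ x) = b₁ (e₀ x)) (h₂ : ∀ x, e₂ (a₂ x) = b₂ (e₁ x)) :
    Nonempty (↥((LinearMap.ker a₂).map (LinearMap.range a₁).mkQ) ≃ₛₗ[σ]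
      ↥((LinearMap.ker b₂).map (LinearMap.range b₁).mkQ)) := by
  have hr := map_range_eq_range_of_commₛₗ a₁ b₁ e₀ e₁ h₁
  -- the quotient map induced by `e₁` and its inverse induced by `e₁⁻¹`
  have hle : LinearMap.range a₁ ≤ (LinearMap.range b₁).comap (e₁ : A₁ →ₛₗ[σ] B₁) :=
    Submodule.map_le_iff_le_comap.1 hr.le
  have hle' : LinearMap.range b₁ ≤ (LinearMap.range a₁).comap (e₁.symm : B₁ →ₛₗ[σ'] A₁) := by
    intro y hy
    rw [← hr] at hy
    obtain ⟨x, hx, rfl⟩ := hy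
    rw [Submodule.mem_comap, LinearEquiv.coe_coe, LinearEquiv.coe_coe, LinearEquiv.symm_apply_apply]
    exact hx
  let f : (A₁ ⧸ LinearMap.range a₁) →ₛₗ[σ] (B₁ ⧸ LinearMap.range b₁) := Submodule.mapQ _ _ (e₁ : A₁ →ₛₗ[σ] B₁) hle
  let g : (B₁ ⧸ LinearMap.range b₁) →ₛₗ[σ'] (A₁ ⧸ LinearMap.range a₁) := Submodule.mapQ _ _ (e₁.symm : B₁ →ₛₗ[σ'] A₁) hle'
  have hfg : f.comp g = LinearMap.id := by
    apply Submodule.linearMap_qext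
    apply LinearMap.ext
    intro y
    simp only [f, g, LinearMap.comp_apply, Submodule.mkQ_apply, Submodule.mapQ_apply, LinearEquiv.coe_coe, LinearEquiv.apply_symm_apply,
      LinearMap.id_apply]
  have hgf : g.comp f = LinearMap.id := by
    apply Submodule.linearMap_qext
    apply LinearMap.ext
    intro x
    simp only [f, g, LinearMap.comp_apply, Submodule.mkQ_apply, Submodule.mapQ_apply, LinearEquiv.coe_coe, LinearEquiv.symm_apply_apply,
      LinearMap.id_apply]
  let E : (A₁ ⧸ LinearMap.range a₁) ≃ₛₗ[σ] (B₁ ⧸ LinearMap.range b₁) := LinearEquiv.ofLinear f g hfg hgf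
  have hE : (E : (A₁ ⧸ LinearMap.range a₁) →ₛₗ[σ] (B₁ ⧸ LinearMap.range b₁)).comp (LinearMap.range a₁).mkQ =
      (LinearMap.range b₁).mkQ.comp (e₁ : A₁ →ₛₗ[σ] B₁) := by
    apply LinearMap.ext
    intro x
    simp only [E, f, LinearMap.comp_apply, Submodule.mkQ_apply, LinearEquiv.coe_coe, LinearEquiv.ofLinear_apply, Submodule.mapQ_apply]
  have hmap : ((LinearMap.ker a₂).map (LinearMap.range a₁).mkQ).map (E : (A₁ ⧸ LinearMap.range a₁) →ₛₗ[σ] (B₁ ⧸ LinearMap.range b₁)) =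
      (LinearMap.ker b₂).map (LinearMap.range b₁).mkQ := by
    rw [← Submodule.map_comp, hE, Submodule.map_comp, map_ker_eq_ker_of_commₛₗ a₂ b₂ e₁ e₂ h₂]
  exact ⟨(E.submoduleMap _).trans (LinearEquiv.ofEq _ _ hmap)⟩

end Semilinear

/-! ## §2 `H^b_mkQ(κ ⊗_A K•)` along a ring isomorphism `κ ≃+* κ′` over `A` -/

section BaseChange

variable {A : Type u} [CommRing A] {κ κ' : Type u} [CommRing κ] [Algebra A κ] [CommRing κ'] [Algebra A κ']
  (K : CochainComplex (ModuleCat.{u} A) ℤ) (e : κ ≃+* κ') (he : ∀ a, e (algebraMap A κ a) = algebraMap A κ' a)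

/-- `e ⊗ 1` intertwines the differentials `d ⊗ κ` and `d ⊗ κ′` of the base-changed complexes (`(e ⊗ 1)(t ⊗ x) = e t ⊗ x`, `(d ⊗ κ)(t ⊗ x) = t ⊗ d x`).
[cite: AtiyahMacdonald1969, Prop. 2.14 and (2.19) (pp. 26–31)] [cite: MumfordAV1970, §5 Lemma 2 (p. 49)] -/
theorem rTensor_baseChange_comm (eA : κ ≃ₐ[A] κ') (i j : ℤ) (x : κ ⊗[A] K.X i) :
    LinearEquiv.rTensor (K.X j) eA.toLinearEquiv ((K.d i j).hom.baseChange κ x) =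
      (K.d i j).hom.baseChange κ' (LinearEquiv.rTensor (K.X i) eA.toLinearEquiv x) := by
  induction x using TensorProduct.induction_on with
  | zero => rw [map_zero, map_zero, map_zero, map_zero]
  | tmul t m => rw [LinearMap.baseChange_tmul, LinearEquiv.rTensor_tmul, LinearEquiv.rTensor_tmul, LinearMap.baseChange_tmul]
  | add x y hx hy => rw [map_add, map_add, hx, hy, map_add, map_add]

include he in
/-- **`H^b_mkQ(κ ⊗_A K•) ≃+ H^b_mkQ(κ′ ⊗_A K•)`, SEMILINEAR over `e`**, for a ring isomorphism `e : κ ≃+* κ′` compatible with the structure maps from `A`: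
an additive bijection `Φ` with `Φ (r • x) = e r • Φ x` (§1 along the degreewise `e ⊗ 1`, ★ `rTensor_algEquiv_smul`; Mathlib `RingHomInvPair.of_ringEquiv`).
The degrees `a b c` are arbitrary. [cite: Weibel1994, §1.1 (Def. 1.1.1, Ex. 1.1.2) (p. 2)] [cite: MumfordAV1970, §5 Cor. 3 (p. 53)] -/
theorem exists_HmkQ_baseChangeComplex_addEquiv_of_ringEquiv (a b c : ℤ) :
    ∃ Φ : ↥((LinearMap.ker ((baseChangeComplex κ K).d b c).hom).map (LinearMap.range ((baseChangeComplex κ K).d a b).hom).mkQ) ≃+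
        ↥((LinearMap.ker ((baseChangeComplex κ' K).d b c).hom).map (LinearMap.range ((baseChangeComplex κ' K).d a b).hom).mkQ),
      ∀ (r : κ) x, Φ (r • x) = e r • Φ x := by
  haveI := RingHomInvPair.of_ringEquiv e
  haveI := RingHomInvPair.of_ringEquiv_symm e
  let eA : κ ≃ₐ[A] κ' := AlgEquiv.ofRingEquiv (f := e) he
  -- the degreewise `e`-semilinear isomorphisms `e ⊗ 1`
  let F : ∀ n : ℤ, ((baseChangeComplex κ K).X n) ≃ₛₗ[(e : κ →+* κ')] ((baseChangeComplex κ' K).X n) := fun n =>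
    { toFun := fun x => LinearEquiv.rTensor (K.X n) eA.toLinearEquiv x
      map_add' := fun x y => map_add _ x y
      map_smul' := fun r x => rTensor_algEquiv_smul eA r x
      invFun := fun y => (LinearEquiv.rTensor (K.X n) eA.toLinearEquiv).symm y
      left_inv := fun x => LinearEquiv.symm_apply_apply _ x
      right_inv := fun y => LinearEquiv.apply_symm_apply _ y }
  obtain ⟨Φ⟩ := nonempty_HmkQ_semilinearEquiv_of_comm (σ := (e : κ →+* κ')) ((baseChangeComplex κ K).d a b).hom ((baseChangeComplex κ K).d b c).hom
    ((baseChangeComplex κ' K).d a b).hom ((baseChangeComplex κ' K).d b c).hom (F a) (F b) (F c)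
    (fun x => rTensor_baseChange_comm K eA a b x) (fun x => rTensor_baseChange_comm K eA b c x)
  exact ⟨Φ.toAddEquiv, fun r x => Φ.map_smulₛₗ r x⟩

include he in
/-- **`finrank_κ H^b_mkQ(κ ⊗_A K•) = finrank_{κ′} H^b_mkQ(κ′ ⊗_A K•)`** for a ring isomorphism `e : κ ≃+* κ′` compatible with the structure maps from `A` (e.g. two
presentations of a residue field, `Scheme.ΓSpecIso`): Mathlib `rank_eq_of_equiv_equiv` for the semilinear additive bijection of
`exists_HmkQ_baseChangeComplex_addEquiv_of_ringEquiv`. [cite: MumfordAV1970, §5 Cor. 3 (p. 53)] [cite: Weibel1994, §1.1 (p. 2)] -/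
theorem finrank_HmkQ_baseChangeComplex_eq_of_ringEquiv (a b c : ℤ) :
    Module.finrank κ ↥((LinearMap.ker ((baseChangeComplex κ K).d b c).hom).map (LinearMap.range ((baseChangeComplex κ K).d a b).hom).mkQ) =
      Module.finrank κ' ↥((LinearMap.ker ((baseChangeComplex κ' K).d b c).hom).map (LinearMap.range ((baseChangeComplex κ' K).d a b).hom).mkQ) := by
  obtain ⟨Φ, hΦ⟩ := exists_HmkQ_baseChangeComplex_addEquiv_of_ringEquiv K e he a b c
  exact congrArg Cardinal.toNat (rank_eq_of_equiv_equiv e Φ e.bijective hΦ)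

include he in
/-- **`Module.Finite κ H^b_mkQ(κ ⊗_A K•) ↔ Module.Finite κ′ H^b_mkQ(κ′ ⊗_A K•)`** along `e : κ ≃+* κ′` over `A` (Mathlib `LinearMap.finite_iff_of_bijective` for the
`e`-semilinear bijection of §1). [cite: MumfordAV1970, §5 Cor. 3 (p. 53)] [cite: Weibel1994, §1.1 (p. 2)] -/
theorem finite_HmkQ_baseChangeComplex_iff_of_ringEquiv (a b c : ℤ) :
    Module.Finite κ ↥((LinearMap.ker ((baseChangeComplex κ K).d b c).hom).map (LinearMap.range ((baseChangeComplex κ K).d a b).hom).mkQ) ↔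
      Module.Finite κ' ↥((LinearMap.ker ((baseChangeComplex κ' K).d b c).hom).map (LinearMap.range ((baseChangeComplex κ' K).d a b).hom).mkQ) := by
  haveI := RingHomInvPair.of_ringEquiv e
  haveI := RingHomInvPair.of_ringEquiv_symm e
  obtain ⟨Φ, hΦ⟩ := exists_HmkQ_baseChangeComplex_addEquiv_of_ringEquiv K e he a b c
  let Ψ : ↥((LinearMap.ker ((baseChangeComplex κ K).d b c).hom).map (LinearMap.range ((baseChangeComplex κ K).d a b).hom).mkQ) →ₛₗ[(e : κ →+* κ')]
      ↥((LinearMap.ker ((baseChangeComplex κ' K).d b c).hom).map (LinearMap.range ((baseChangeComplex κ' K).d a b).hom).mkQ) :=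
    { toFun := Φ, map_add' := fun x y => map_add Φ x y, map_smul' := fun r x => hΦ r x }
  exact LinearMap.finite_iff_of_bijective Ψ Φ.bijective

end BaseChange

end Literature.Algebra.Homology

end
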